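import Literature.NumberTheory.LFunctions.GranvilleSoundararajanLemma23
import Literature.NumberTheory.LFunctions.GranvilleSoundararajanTheorem3
import Literature.NumberTheory.LFunctions.GranvilleSoundararajan2003Proofs
import HarnessLib

/-!
# Granville–Soundararajan 2003: Lemma 2.3 in the range `|β| ≤ 4 log x`, and Theorem 3 (discharge)

Topic `Literature/NumberTheory/LFunctions`.  Everything in this file is PROVED; it DISCHARGES the named
fact `GranvilleSoundararajan2003_theorem3` of `GranvilleSoundararajan2003.lean`
(A. Granville, K. Soundararajan, *Decay of mean values of multiplicative functions*, Canad. J. Math. 55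
(2003), Theorem 3; arXiv math/9911246, p. 2, proof §5 p. 9).

The tree already has:
* `GranvilleSoundararajan2003_theorem3_of` (`GranvilleSoundararajanTheorem3.lean`): the deduction of
  Theorem 3 from Theorem 1 and Lemma 2.3 **in the range `1/log x ≤ |β| ≤ 4 log x`** (§5 applies
  Lemma 2.3 with `β = y - y₀`, `|β| ≤ 2|y₀| - 2 ≤ 4 log x - 2`, "`log x ≫ |β|`");
* `GranvilleSoundararajan2003_theorem1_holds` (`GranvilleSoundararajan2003Proofs.lean`);
* `GranvilleSoundararajan2003_lemma23_holds` and its prime-sum core `sum_abs_cos_log_prime_div_le`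
  (`GranvilleSoundararajanLemma23.lean`, `GranvilleSoundararajanCosPrimeSum.lean`), in the printed
  range `|β| ≤ log x`.

Here the range is extended to `|β| ≤ 4 log x` by a one-line device: the prime sum
`∑_{p ≤ x} |cos((β/2) log p)|/p` has nonnegative terms, so it is at most the same sum over `p ≤ x⁴`,
to which the printed range applies (`log x⁴ = 4 log x ≥ |β|`, `1/log x⁴ ≤ 1/log x ≤ |β|`); and
`log log x⁴ = log 4 + log log x`, `max(1/|β|, (log 4 + log log x)²) ≤ 65 max(1/|β|, (log log x)²)`
(for `log log x ≥ 1` because `(log 4 + u)² ≤ 6u²`; for `log log x < 1` because then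
`|β| ≤ 4 log x < 4e`, so the maximum is `> 1/11`).  This is the remark of the printed proof of
Lemma 2.3 that the upper limit for `|β|` only affects the implied constant.

* `sum_abs_cos_log_prime_div_le_range4` — the prime sum for `1/log x ≤ |β| ≤ 4 log x`;
* `lemma23_range4` — Lemma 2.3 for `1/log x ≤ |β| ≤ 4 log x` (the hypothesis of `…theorem3_of`);
* `GranvilleSoundararajan2003_theorem3_holds : GranvilleSoundararajan2003_theorem3`.

## References
* A. Granville, K. Soundararajan, *Decay of mean values of multiplicative functions*, Canad. J. Math.
  55 (2003), 1191–1230: Lemma 2.3 and its proof (arXiv p. 5), Theorem 3 (p. 2), §5 (p. 9).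
  [GranvilleSoundararajan2003]
-/

noncomputable section

open Finset Real Complex

namespace Literature.NumberTheory.LFunctions.GranvilleSoundararajan

/-- The comparison of the two maxima: for `x ≥ 3` and `|β| ≤ 4 log x`,
`max(1/|β|, (log 4 + log log x)²) ≤ 65 · max(1/|β|, (log log x)²)`. [folklore] -/
theorem max_loglog_pow_four_le {x β : ℝ} (hx : 3 ≤ x) (hβ0 : 0 < |β|) (hβ : |β| ≤ 4 * Real.log x) :
    max (1 / |β|) ((Real.log 4 + Real.log (Real.log x)) ^ 2) ≤
      65 * max (1 / |β|) (Real.log (Real.log x) ^ 2) := by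
  set u := Real.log (Real.log x) with hu
  set m := max (1 / |β|) (u ^ 2) with hm
  have hlog3 : 1 < Real.log x := by
    rw [← Real.log_exp 1]
    refine Real.log_lt_log (Real.exp_pos 1) (lt_of_lt_of_le ?_ hx)
    have := Real.exp_one_lt_d9; linarith
  have hu0 : 0 < u := Real.log_pos hlog3
  have hm1 : 1 / |β| ≤ m := le_max_left _ _
  have hm2 : u ^ 2 ≤ m := le_max_right _ _
  have hm0 : 0 < m := lt_of_lt_of_le (by positivity) hm1
  have hl4 : Real.log 4 < 1.3863 := by
    have h : Real.log 4 = 2 * Real.log 2 := by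
      rw [show (4 : ℝ) = 2 ^ 2 by norm_num, Real.log_pow]; norm_num
    rw [h]
    have := Real.log_two_lt_d9
    linarith
  have hl40 : 0 < Real.log 4 := Real.log_pos (by norm_num)
  refine max_le (by linarith) ?_
  by_cases hu1 : 1 ≤ u
  · -- `(log 4 + u)² ≤ (2.39 u)² ≤ 6 u² ≤ 65 m`
    have h1 : Real.log 4 + u ≤ 2.39 * u := by nlinarith
    have h2 : (Real.log 4 + u) ^ 2 ≤ (2.39 * u) ^ 2 := pow_le_pow_left₀ (by linarith) h1 2
    nlinarith
  · -- `u < 1`: `log x < e`, `|β| < 4e < 11`, `m > 1/11`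
    push Not at hu1
    have hlogx : Real.log x < Real.exp 1 := by
      have : Real.log (Real.log x) < 1 := hu1
      rwa [Real.log_lt_iff_lt_exp (by linarith)] at this
    have he : Real.exp 1 < 2.7182818286 := Real.exp_one_lt_d9
    have hβ11 : |β| < 11 := by linarith
    have hm11 : 1 / 11 < m := lt_of_lt_of_le (by rw [div_lt_div_iff₀ (by norm_num) hβ0]; linarith) hm1
    have h3 : (Real.log 4 + u) ^ 2 < 5.72 := by nlinarith
    linarith

/-- **The prime sum of Lemma 2.3 in the range `|β| ≤ 4 log x`**: there is an absolute `K` with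
`∑_{p ≤ x} |cos((β/2) log p)|/p ≤ (2/π) log log x + (1 - 2/π) log max(1/|β|, (log log x)²) + K`
for `x ≥ 3`, `1/log x ≤ |β| ≤ 4 log x` (from the printed range at `x⁴`, by positivity of the terms).
[cite: GranvilleSoundararajan2003, proof of Lemma 2.3] -/
theorem sum_abs_cos_log_prime_div_le_range4 :
    ∃ K : ℝ, ∀ x : ℝ, 3 ≤ x → ∀ β : ℝ, 1 / Real.log x ≤ |β| → |β| ≤ 4 * Real.log x →
      ∑ p ∈ Nat.primesLE ⌊x⌋₊, |Real.cos (β / 2 * Real.log p)| / p ≤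
        2 / π * Real.log (Real.log x) +
          (1 - 2 / π) * Real.log (max (1 / |β|) (Real.log (Real.log x) ^ 2)) + K := by
  obtain ⟨K, hK⟩ := sum_abs_cos_log_prime_div_le
  refine ⟨K + Real.log 4 + Real.log 65, fun x hx β hβ1 hβ2 => ?_⟩
  have hx1 : 1 < x := by linarith
  have hlog : 0 < Real.log x := Real.log_pos hx1
  have hβ0 : 0 < |β| := lt_of_lt_of_le (by positivity) hβ1
  -- pass to `x⁴`
  set x' : ℝ := x ^ 4 with hx'
  have hxx' : x ≤ x' := by
    rw [hx']
    calc x = x ^ 1 := (pow_one x).symm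
      _ ≤ x ^ 4 := pow_le_pow_right₀ hx1.le (by norm_num)
  have hx'3 : 3 ≤ x' := hx.trans hxx'
  have hlog' : Real.log x' = 4 * Real.log x := by rw [hx', Real.log_pow]; norm_num
  have hβ1' : 1 / Real.log x' ≤ |β| := by
    refine le_trans ?_ hβ1
    rw [hlog']
    exact one_div_le_one_div_of_le hlog (by linarith)
  have hβ2' : |β| ≤ Real.log x' := by rw [hlog']; exact hβ2
  have hweak := hK x' hx'3 β hβ1' hβ2'
  -- monotonicity in `x`
  have hmono : ∑ p ∈ Nat.primesLE ⌊x⌋₊, |Real.cos (β / 2 * Real.log p)| / p ≤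
      ∑ p ∈ Nat.primesLE ⌊x'⌋₊, |Real.cos (β / 2 * Real.log p)| / p :=
    Finset.sum_le_sum_of_subset_of_nonneg (Nat.primesLE_mono (Nat.floor_le_floor hxx'))
      fun p _ _ => by positivity
  refine hmono.trans (hweak.trans ?_)
  -- compare the right-hand sides
  have hll : Real.log (Real.log x') = Real.log 4 + Real.log (Real.log x) := by
    rw [hlog', Real.log_mul (by norm_num) hlog.ne']
  rw [hll]
  set m := max (1 / |β|) (Real.log (Real.log x) ^ 2) with hm
  have hm0 : 0 < m := lt_of_lt_of_le (by positivity) (le_max_left _ _)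
  have hmax := max_loglog_pow_four_le hx hβ0 hβ2
  rw [← hm] at hmax
  have hmaxpos : 0 < max (1 / |β|) ((Real.log 4 + Real.log (Real.log x)) ^ 2) :=
    lt_of_lt_of_le (by positivity) (le_max_left _ _)
  have hlogmax : Real.log (max (1 / |β|) ((Real.log 4 + Real.log (Real.log x)) ^ 2)) ≤
      Real.log 65 + Real.log m := by
    rw [← Real.log_mul (by norm_num) hm0.ne']
    exact Real.log_le_log hmaxpos hmax
  have hpi1 : 2 / π ≤ 1 := by
    rw [div_le_one Real.pi_pos]; linarith [Real.pi_gt_three]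
  have hpi0 : 0 ≤ 2 / π := by positivity
  have hb0 : 0 ≤ 1 - 2 / π := by linarith
  have hb1 : 1 - 2 / π ≤ 1 := by linarith
  have hl4 : 0 ≤ Real.log 4 := Real.log_nonneg (by norm_num)
  have hl65 : 0 ≤ Real.log 65 := Real.log_nonneg (by norm_num)
  have e1 : 2 / π * (Real.log 4 + Real.log (Real.log x)) ≤ Real.log 4 + 2 / π * Real.log (Real.log x) := by
    nlinarith
  have e2 : (1 - 2 / π) * Real.log (max (1 / |β|) ((Real.log 4 + Real.log (Real.log x)) ^ 2)) ≤
      Real.log 65 + (1 - 2 / π) * Real.log m := by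
    calc (1 - 2 / π) * Real.log (max (1 / |β|) ((Real.log 4 + Real.log (Real.log x)) ^ 2))
        ≤ (1 - 2 / π) * (Real.log 65 + Real.log m) := mul_le_mul_of_nonneg_left hlogmax hb0
      _ = (1 - 2 / π) * Real.log 65 + (1 - 2 / π) * Real.log m := by ring
      _ ≤ Real.log 65 + (1 - 2 / π) * Real.log m := by nlinarith
  linarith

/-- **Granville–Soundararajan 2003, Lemma 2.3 in the range `1/log x ≤ |β| ≤ 4 log x`** (absolute
constant): `|F(1+iy) F(1+i(y+β))| ≤ C (log x)^{4/π} max(1/|β|, (log log x)²)^{2(1-2/π)}` — the form used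
in §5 of the paper and hypothesised by `GranvilleSoundararajan2003_theorem3_of`.
[cite: GranvilleSoundararajan2003, Lemma 2.3 and §5] -/
theorem lemma23_range4 :
    ∃ C : ℝ, ∀ f : ArithmeticFunction ℂ, f.IsMultiplicative → (∀ n, ‖f n‖ ≤ 1) →
      ∀ x : ℝ, 3 ≤ x → ∀ y β : ℝ, 1 / Real.log x ≤ |β| → |β| ≤ 4 * Real.log x →
        ‖truncEulerProduct f x (1 + y * I) * truncEulerProduct f x (1 + (y + β) * I)‖ ≤
          C * Real.log x ^ (4 / Real.pi) *
            (max (1 / |β|) (Real.log (Real.log x) ^ 2)) ^ (2 * (1 - 2 / Real.pi)) := by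
  obtain ⟨K, hK⟩ := sum_abs_cos_log_prime_div_le_range4
  refine ⟨Real.exp (6 + 2 * K), fun f hf hfb x hx y β hβ1 hβ2 => ?_⟩
  have hx0 : 0 < x := by linarith
  have hlog : 0 < Real.log x := Real.log_pos (by linarith)
  have hβ : 0 < |β| := lt_of_lt_of_le (by positivity) hβ1
  set M : ℝ := max (1 / |β|) (Real.log (Real.log x) ^ 2) with hM
  have hM0 : 0 < M := lt_of_lt_of_le (by positivity) (le_max_left _ _)
  have h1 := norm_truncEulerProduct_mul_le hfb hf.map_one x y β
  have h2 := hK x hx β hβ1 hβ2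
  rw [← hM] at h2
  have h3 : 2 * ∑ p ∈ Nat.primesLE ⌊x⌋₊, |Real.cos (β / 2 * Real.log p)| / p ≤
      2 * (2 / π * Real.log (Real.log x) + (1 - 2 / π) * Real.log M + K) := by linarith
  calc ‖truncEulerProduct f x (1 + y * I) * truncEulerProduct f x (1 + (y + β) * I)‖
      ≤ Real.exp 6 * Real.exp (2 * ∑ p ∈ Nat.primesLE ⌊x⌋₊, |Real.cos (β / 2 * Real.log p)| / p) := h1
    _ ≤ Real.exp 6 * Real.exp (2 * (2 / π * Real.log (Real.log x) + (1 - 2 / π) * Real.log M + K)) := by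
        gcongr
    _ = Real.exp (6 + 2 * K) * Real.log x ^ (4 / π) * M ^ (2 * (1 - 2 / π)) := by
        rw [Real.rpow_def_of_pos hlog, Real.rpow_def_of_pos hM0, ← Real.exp_add, ← Real.exp_add,
          ← Real.exp_add]
        congr 1; ring

/-- **Granville–Soundararajan 2003, Theorem 3** — PROVED (discharge of the named fact): for
multiplicative `f` with `|f| ≤ 1`, `x ≥ 3` and every maximiser `y₀` of `|F(1+iy)|` on `|y| ≤ 2 log x`,
`x⁻¹|∑_{n≤x} f(n)| ≤ C(1/(1+|y₀|) + (log log x)^{1+2(1-2/π)}/(log x)^{1-2/π})`, from Theorem 1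
(`GranvilleSoundararajan2003_theorem1_holds`), Lemma 2.3 for `|β| ≤ 4 log x` (`lemma23_range4`) and the
§5 deduction `GranvilleSoundararajan2003_theorem3_of`. [cite: GranvilleSoundararajan2003, Theorem 3] -/
theorem GranvilleSoundararajan2003_theorem3_holds : GranvilleSoundararajan2003_theorem3 :=
  GranvilleSoundararajan2003_theorem3_of GranvilleSoundararajan2003_theorem1_holds lemma23_range4

end Literature.NumberTheory.LFunctions.GranvilleSoundararajan
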